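import Summits.AtomisticToContinuum.Crystallization.Theses.FluxTubeKepler

/-!
# `FluxCellKepler` (stmt-AtomisticToContinuum-15221), line `Sketch` — helper: counting half of the
# single-scale collapse (`stub_badCountTransfer`)

The KEPLER conjunct of `FluxTubeKepler.FluxCellKepler` prices the `(R, η)`-bad sites at every scale
`R`; the card `single-scale-collapse` reduces it to one scale `R₀` plus a gluing lemma "every
`(R, η)`-bad site has an `(R₀, η')`-bad site within `3R`".  This file is the potential-free COUNTING
half of that reduction, for abstract predicates `bad₁`, `bad₂` on a `δ`-separated finite
configuration of `ℝ³`: if every `bad₁`-site has a `bad₂`-site within distance `ρ`, then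
`#bad₁ ≤ (2ρ/δ + 1)³ · #bad₂`.

Proof (double counting + packing): `bad₁ ⊆ ⋃_{j ∈ bad₂} fibre_j` with
`fibre_j = {i | dist (x i) (x j) ≤ ρ}`, so `#bad₁ ≤ Σ_{j ∈ bad₂} #fibre_j`
(`Finset.card_biUnion_le`), and each fibre is a `δ`-separated subset of the ball of radius `ρ`
about `x j`, hence has at most `(2ρ/δ + 1)³` members by the packing bound
`Literature.MathematicalPhysics.StatisticalMechanics.card_le_of_separated_of_dist_le`
(`x` is injective on indices since `δ > 0`).
-/

noncomputable section

namespace Summit.AtomisticToContinuum.Crystallization.Theorems.FluxCellKeplerSketchCount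

open scoped BigOperators
open Literature.MathematicalPhysics.StatisticalMechanics

/-- **Counting half of the single-scale collapse** (line `Sketch`, stub `stub_badCountTransfer`):
on a `δ`-separated finite configuration of `ℝ³`, if every `bad₁`-site has a `bad₂`-site within
distance `ρ`, then `#bad₁ ≤ (2ρ/δ + 1)³ · #bad₂` — double counting over the fibres
`{i | dist (x i) (x j) ≤ ρ}`, `j ∈ bad₂`, each of which has at most `(2ρ/δ + 1)³` members by the
packing bound `card_le_of_separated_of_dist_le`. [folklore] -/
theorem stub_badCountTransfer : ∀ (δ ρ : ℝ), 0 < δ → 0 ≤ ρ → ∀ (N : ℕ) (x : Fin N → EuclideanSpace ℝ (Fin 3)) (bad₁ bad₂ : Fin N → Prop), (∀ i j, i ≠ j → δ ≤ dist (x i) (x j)) → (∀ i, bad₁ i → ∃ j, bad₂ j ∧ dist (x i) (x j) ≤ ρ) → (Nat.card {i : Fin N // bad₁ i} : ℝ) ≤ (2 * ρ / δ + 1) ^ 3 * (Nat.card {j : Fin N // bad₂ j} : ℝ) := by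
  intro δ ρ hδ hρ N x bad₁ bad₂ hsep hnear
  classical
  set C : ℝ := (2 * ρ / δ + 1) ^ 3 with hC_def
  -- `δ`-separation with `δ > 0` forces injectivity of `x` on indices
  have hinj : Function.Injective x := by
    intro i j hij
    by_contra hne
    have := hsep i j hne
    rw [hij, dist_self] at this
    linarith
  set B₁ : Finset (Fin N) := Finset.univ.filter fun i : Fin N => bad₁ i with hB₁_def
  set B₂ : Finset (Fin N) := Finset.univ.filter fun j : Fin N => bad₂ j with hB₂_def
  have hB₁card : (Nat.card {i : Fin N // bad₁ i} : ℝ) = B₁.card := by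
    rw [Nat.card_eq_fintype_card, Fintype.card_subtype]
  have hB₂card : (Nat.card {j : Fin N // bad₂ j} : ℝ) = B₂.card := by
    rw [Nat.card_eq_fintype_card, Fintype.card_subtype]
  -- the fibres `{i | dist (x i) (x j) ≤ ρ}` have at most `C` members each (packing)
  have hfib : ∀ j ∈ B₂,
      ((Finset.univ.filter fun i : Fin N => dist (x i) (x j) ≤ ρ).card : ℝ) ≤ C := by
    intro j _
    have h := card_le_of_separated_of_dist_le
      ((Finset.univ.filter fun i : Fin N => dist (x i) (x j) ≤ ρ).image x) (x j) hδ hρ ?_ ?_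
    · rw [Finset.card_image_of_injective _ hinj, finrank_euclideanSpace_fin] at h
      exact h
    · intro c hc
      obtain ⟨i, hi, rfl⟩ := Finset.mem_image.1 hc
      exact (Finset.mem_filter.1 hi).2
    · intro c hc d hd hcd
      obtain ⟨i, -, rfl⟩ := Finset.mem_image.1 hc
      obtain ⟨i', -, rfl⟩ := Finset.mem_image.1 hd
      exact hsep i i' fun h => hcd (by rw [h])
  -- `bad₁` is covered by the fibres over `bad₂`
  have hcover : B₁ ⊆ B₂.biUnion fun j => Finset.univ.filter fun i : Fin N => dist (x i) (x j) ≤ ρ := by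
    intro i hi
    obtain ⟨j, hj, hij⟩ := hnear i (Finset.mem_filter.1 hi).2
    rw [Finset.mem_biUnion]
    exact ⟨j, Finset.mem_filter.2 ⟨Finset.mem_univ _, hj⟩,
      Finset.mem_filter.2 ⟨Finset.mem_univ _, hij⟩⟩
  -- double counting
  have h1 : (B₁.card : ℝ) ≤ C * B₂.card := by
    have h2 := Finset.card_le_card hcover
    have h3 := Finset.card_biUnion_le (s := B₂)
      (t := fun j => Finset.univ.filter fun i : Fin N => dist (x i) (x j) ≤ ρ)
    calc (B₁.card : ℝ)
        ≤ ((B₂.biUnion fun j => Finset.univ.filter fun i : Fin N => dist (x i) (x j) ≤ ρ).card : ℝ) := by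
          exact_mod_cast h2
      _ ≤ ((∑ j ∈ B₂, (Finset.univ.filter fun i : Fin N => dist (x i) (x j) ≤ ρ).card : ℕ) : ℝ) := by
          exact_mod_cast h3
      _ = ∑ j ∈ B₂, ((Finset.univ.filter fun i : Fin N => dist (x i) (x j) ≤ ρ).card : ℝ) := by
          push_cast; rfl
      _ ≤ ∑ j ∈ B₂, C := Finset.sum_le_sum hfib
      _ = C * B₂.card := by rw [Finset.sum_const, nsmul_eq_mul, mul_comm]
  rw [hB₁card, hB₂card]
  exact h1

end Summit.AtomisticToContinuum.Crystallization.Theorems.FluxCellKeplerSketchCount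

end
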